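import Mathlib
import Summits.Ventures.PercRepro2.Induced
import Summits.Ventures.PercRepro2.Harris
import Summits.Ventures.PercRepro2.BlockSubstLaw

/-!
# Block substitution: deletions at terminals, and the support configuration
(blind cell PercRepro2, mine-2 g33)

Two more transports for a block substitution (`IsBlockSubst`, `BlockSubstConn.lean`):

* **deletions at terminals** — closing every edge at a set of terminals `q '' W'` in the graph
  (`delConfig`, `Induced.lean`) is, on the pattern, closing every skeleton edge at `W'`
  (`bsOpen_delConfig`, the skeleton loop-free): a block touched by a deleted terminal cannot
  connect its terminals (the edges at that terminal are closed — the closure lemma on the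
  singleton), an untouched block keeps its configuration; hence `conn_delConfig_marks_iff` —
  the connectivity of the terminals after a deletion is the skeleton connectivity after the same
  deletion.  This carries the lead's five separation classes from the skeleton to the graph
  (`SixTerminalClasses.lean`);
* **the support configuration** `suppCfg p` (the edges of positive weight): it has positive
  weight, it dominates every configuration of positive weight, and a block has positive weight
  iff it connects its terminals at the support configuration (`bsProb_pos_iff`) — so the skeleton
  mask of the locus theorems is the block pattern of the support configuration.
-/

namespace Summit.Ventures.PercRepro2

namespace BlockSubst

section Del

variable {V : Type*} {E : Type*} {V' : Type*} {E' : Type*} [DecidableEq E']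
variable {ends : E → Sym2 V} {ends' : E' → Sym2 V'} {q : V' → V} {blk : E → E'} {Vj : E' → Set V}

omit [DecidableEq E'] in
/-- An edge touching a deleted terminal lies in a block at that terminal. -/
lemma exists_mem_ends'_of_mem_touches (hB : IsBlockSubst ends ends' q blk Vj) {e : E}
    {W' : Set V'} (he : e ∈ touches ends (q '' W')) : ∃ k ∈ W', k ∈ ends' (blk e) := by
  obtain ⟨x, hx, y, hxy⟩ := he
  obtain ⟨k, hk, rfl⟩ := hx
  have : q k ∈ Vj (blk e) := hB.ends_mem e (q k) (by rw [hxy]; exact Sym2.mem_mk_left _ _)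
  exact ⟨k, hk, hB.term_only _ _ this⟩

/-- A block at no deleted terminal keeps its configuration under the deletion. -/
lemma blockCfg_delConfig_of_not_touch (hB : IsBlockSubst ends ends' q blk Vj) {W' : Set V'}
    {j : E'} (hj : ∀ k ∈ W', k ∉ ends' j) (ω : Config E) :
    blockCfg blk j (delConfig ends (q '' W') ω) = blockCfg blk j ω := by
  apply blockCfg_congr
  intro e he
  apply delConfig_apply_of_notMem
  intro ht
  obtain ⟨k, hk, hkj⟩ := exists_mem_ends'_of_mem_touches hB ht
  rw [Set.mem_setOf_eq] at he
  rw [he] at hkj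
  exact hj k hk hkj

/-- A block at a deleted terminal is closed after the deletion (the skeleton edge not a loop). -/
lemma bsOpen_delConfig_of_touch (hB : IsBlockSubst ends ends' q blk Vj) {W' : Set V'} {j : E'}
    (hloop : ¬ (ends' j).IsDiag) {k : V'} (hk : k ∈ W') (hkj : k ∈ ends' j) (ω : Config E) :
    bsOpen ends ends' q blk (delConfig ends (q '' W') ω) j = false := by
  rw [bsOpen_eq_false_iff]
  intro h
  obtain ⟨k', hk'⟩ := Sym2.mem_iff_exists.1 hkj
  have hne : k ≠ k' := fun h' => hloop (by rw [hk', h']; exact Sym2.mk_isDiag_iff.2 rfl)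
  have hc := h k k' hk'
  -- the within-block cluster of `q k` after the deletion is `{q k}`
  have hclosed : ∀ x ∈ ({q k} : Set V), ∀ y,
      (openGraph ends (blockCfg blk j (delConfig ends (q '' W') ω))).Adj x y →
        y ∈ ({q k} : Set V) := by
    intro x hx y hxy
    rw [Set.mem_singleton_iff] at hx
    subst hx
    rw [openGraph_adj] at hxy
    obtain ⟨_, e, he, hends⟩ := hxy
    obtain ⟨he1, _⟩ := of_blockCfg_eq_true he
    have ht : e ∈ touches ends (q '' W') := ⟨q k, ⟨k, hk, rfl⟩, y, hends⟩
    rw [delConfig_apply_of_mem ht] at he1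
    exact absurd he1 Bool.false_ne_true
  have := mem_of_conn_of_closed hclosed (Set.mem_singleton _) hc
  rw [Set.mem_singleton_iff] at this
  exact hne (hB.q_inj this).symm

/-- **The pattern of a deletion at terminals is the deletion on the skeleton**: closing every
edge at the terminals `q '' W'` closes, on the pattern, every skeleton edge at `W'` (the skeleton
loop-free). -/
theorem bsOpen_delConfig (hB : IsBlockSubst ends ends' q blk Vj) (hloop : ∀ j, ¬ (ends' j).IsDiag)
    (W' : Set V') (ω : Config E) :
    bsOpen ends ends' q blk (delConfig ends (q '' W') ω) =
      delConfig ends' W' (bsOpen ends ends' q blk ω) := by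
  funext j
  by_cases hj : j ∈ touches ends' W'
  · obtain ⟨k, hk, k', hkk'⟩ := hj
    rw [delConfig_apply_of_mem ⟨k, hk, k', hkk'⟩]
    exact bsOpen_delConfig_of_touch hB (hloop j) hk (by rw [hkk']; exact Sym2.mem_mk_left _ _) ω
  · rw [delConfig_apply_of_notMem hj]
    have hj' : ∀ k ∈ W', k ∉ ends' j := by
      intro k hk hkj
      obtain ⟨y, hy⟩ := Sym2.mem_iff_exists.1 hkj
      exact hj ⟨k, hk, y, hy⟩
    unfold bsOpen
    rw [blockCfg_delConfig_of_not_touch hB hj' ω]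

/-- **Connectivity of the terminals after a deletion at terminals** is the skeleton connectivity
after the same deletion. -/
theorem conn_delConfig_marks_iff (hB : IsBlockSubst ends ends' q blk Vj)
    (hloop : ∀ j, ¬ (ends' j).IsDiag) (W' : Set V') (ω : Config E) (k k' : V') :
    Conn ends (delConfig ends (q '' W') ω) (q k) (q k') ↔
      Conn ends' (delConfig ends' W' (bsOpen ends ends' q blk ω)) k k' := by
  rw [conn_marks_iff_bs hB, bsOpen_delConfig hB hloop]

end Del

section Support

variable {V : Type*} {E : Type*} {V' : Type*} {E' : Type*} [Fintype E] [DecidableEq E]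
  [DecidableEq E'] {R : Type*} [Field R] [LinearOrder R] [IsStrictOrderedRing R]
variable {ends : E → Sym2 V} {ends' : E' → Sym2 V'} {q : V' → V} {blk : E → E'}

/-- **The support configuration** of a weight vector: the edges of positive weight. -/
noncomputable def suppCfg (p : E → R) : Config E := fun e => decide (0 < p e)

omit [DecidableEq E] in
/-- The support configuration has positive weight. -/
lemma weight_suppCfg_pos {p : E → R} (hp : IsProbVec p) : 0 < weight p (suppCfg p) := by
  unfold weight
  apply Finset.prod_pos
  intro e _
  by_cases h : 0 < p e
  · simp [suppCfg, h, edgeFactor]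
  · have h0 : p e = 0 := le_antisymm (not_lt.1 h) (hp.nonneg e)
    simp [suppCfg, edgeFactor, h0]

omit [DecidableEq E] [IsStrictOrderedRing R] in
/-- A configuration of positive weight lies below the support configuration. -/
lemma le_suppCfg_of_weight_pos {p : E → R} (hp : IsProbVec p) {ω : Config E}
    (h : 0 < weight p ω) : ω ≤ suppCfg p := by
  intro e
  cases hω : ω e
  · exact Bool.false_le _
  · have hpe : 0 < p e := by
      by_contra hle
      have h0 : p e = 0 := le_antisymm (not_lt.1 hle) (hp.nonneg e)
      have : weight p ω = 0 := by
        unfold weight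
        exact Finset.prod_eq_zero (Finset.mem_univ e) (by simp [hω, edgeFactor, h0])
      rw [this] at h
      exact lt_irrefl _ h
    simp [suppCfg, hpe]

/-- An event has positive probability iff it contains a configuration of positive weight. -/
lemma prob_pos_iff {p : E → R} (hp : IsProbVec p) (A : Set (Config E)) :
    0 < prob p A ↔ ∃ ω ∈ A, 0 < weight p ω := by
  constructor
  · intro h
    by_contra hno
    have hzero : prob p A = 0 := by
      unfold prob
      refine Finset.sum_eq_zero fun ω _ => ?_
      by_cases hω : ω ∈ A
      · rw [Set.indicator_of_mem hω]
        by_contra hw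
        exact hno ⟨ω, hω, lt_of_le_of_ne (weight_nonneg hp ω) (Ne.symm hw)⟩
      · exact Set.indicator_of_notMem hω _
    rw [hzero] at h
    exact lt_irrefl _ h
  · rintro ⟨ω, hω, hw⟩
    unfold prob
    calc (0 : R) < A.indicator (weight p) ω := by rw [Set.indicator_of_mem hω]; exact hw
      _ ≤ ∑ ω', A.indicator (weight p) ω' :=
          Finset.single_le_sum (fun ω' _ => Set.indicator_apply_nonneg fun _ => weight_nonneg hp ω')
            (Finset.mem_univ ω)

omit [Fintype E] [DecidableEq E] in
/-- The block configuration is monotone in the configuration. -/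
lemma blockCfg_mono {j : E'} {ω ω' : Config E} (h : ω ≤ ω') :
    blockCfg blk j ω ≤ blockCfg blk j ω' := by
  intro e
  have h' := h e
  simp only [blockCfg]
  cases hω : ω e
  · simp
  · rw [hω] at h'
    have : ω' e = true := by
      cases hω' : ω' e
      · rw [hω'] at h'
        exact absurd (Bool.le_iff_imp.1 h' rfl) Bool.false_ne_true
      · rfl
    rw [this]

/-- **A block has positive weight iff it connects its terminals at the support configuration.** -/
theorem bsProb_pos_iff {p : E → R} (hp : IsProbVec p) (j : E') :
    0 < bsProb ends ends' q blk p j ↔ bsOpen ends ends' q blk (suppCfg p) j = true := by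
  unfold bsProb
  rw [prob_pos_iff hp]
  constructor
  · rintro ⟨ω, hω, hw⟩
    have hle := le_suppCfg_of_weight_pos hp hw
    rw [Set.mem_setOf_eq, bsOpen_eq_true_iff] at hω
    rw [bsOpen_eq_true_iff]
    intro x y hxy
    exact conn_mono (blockCfg_mono hle) (hω x y hxy)
  · intro h
    exact ⟨suppCfg p, h, weight_suppCfg_pos hp⟩

end Support

end BlockSubst

end Summit.Ventures.PercRepro2
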